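import Summits.QuantumFields.YangMills.Theorems.LuscherReductionTwistedTraceScalingStepKernelModel
import Summits.QuantumFields.YangMills.Theorems.LuscherReductionTwistedTraceScalingStepNearFar
import Summits.QuantumFields.YangMills.Theorems.LuscherReductionTwistedTraceScalingGaussianTail
import HarnessLib

/-!
# The transfer step at a small-action configuration is dominated by the Gaussian model integral on the link space
# (covariant programme, brick c4(iii)-step IV: the UPPER = super-solution direction, assembled)

Cell `ym-fleet`, crux `TwistedTraceScaling` (stmt-QuantumFields-20203), line «twolattice», stub S-BASE, lane B = COARSE-LOWER(L₁)
(design note `pub/ym-fleet/ym-20203-coarse-s1/LOWER-BLUEPRINT.md` §5–§6, c4).  HONEST FRAMING: fixed-lattice bookkeeping; a stub of a child of the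
CONDITIONAL reduction route (femto rung R2b1); not a gap, not Clay.

For `β > 0`, a measurable `0 ≤ Φ ≤ C`, a configuration `U` with `S(U) ≤ σ ≤ 1/16`, a near threshold `δ < 1` and a chart radius `ρ ≤ 1/100` with
`(1−δ)⁻² − 1 ≤ ρ²` (so NEAR steps have `|y_e| ≤ ρ`):

* `chartBall ρ` — the chart ball `{x ∈ LinkSpace L | Σ_a x(e,a)² ≤ ρ² ∀e}` (closed, measurable);
* `upperModel` — the model integrand `x ↦ 𝟙_{ball}(x) e^{−β(1+ρ²)⁻²‖x‖²} e^{−(β/2)‖F(U) + D_U x‖²} Φ(P(x)·U)` on `LinkSpace L` (integrable: Gaussian domination);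
* ★★ `transferApply_le_far_add_model` —
  `(K_β Φ)(U) ≤ e^{2β|E|} e^{−2βδ} C + (2π²)^{−|E|} e^{2β|E|} e^{(β/2)(η₁ + θ)} e^{−(β/2)S(U)} ∫_{LinkSpace} upperModel`,
  `η₁ = stepErrLo ρ σ N`, `θ = chartErr ρ σ N` — near/far (`…StepNearFar`) + chart kernel sandwich (`…StepKernelModel`) + gnomonic density
  `≤ (2π²)^{−|E|}` + volume-preserving transport `y ↦ chartVec y` (`GnChart.integral_comp_chartVec`).
The remaining step to a POINTWISE super-solution bound `(K_β H)(U) ≤ Λ e^{o(1)} H(U)` is to bound `Φ(P(x)·U)` for the covariant trial state by the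
model weight `e^{−q_{D_U}(F(U) + D_U x)}` (`…SpectralWeightBounds`, `…SpectralWeightContinuity`) and integrate with `…HarmonicStepIntegral`.

## References
* M. Lüscher, Nucl. Phys. B219 (1983) 233, §3. [Luscher1983]
* E. Seiler, LNP 159 (1982), §3. [SeilerLNP1982]
-/

noncomputable section

open MeasureTheory Real
open Literature.MathematicalPhysics.QuantumFieldTheory
open Literature.MathematicalPhysics.QuantumLattice

namespace Summit.QuantumFields.YangMills.Theorems.FemtoTransferGap.TwoLattice.Cov

open Summit.QuantumFields.YangMills.Theorems.FemtoTransferGap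
open Summit.QuantumFields.YangMills.Theorems.FemtoTransferGap.TwoLattice
open Summit.QuantumFields.YangMills.Theorems.FemtoTransferGap.TwoLattice.Stiff
open Summit.QuantumFields.YangMills.Theorems.FemtoTransferGap.TwoLattice.GnChart

variable {L : ℕ} [NeZero L]

/-! ## §1 The chart ball in the link space -/

variable (L) in
/-- The chart ball of radius `ρ`: every link coordinate in the Euclidean `ρ`-ball. [folklore] -/
def chartBall (ρ : ℝ) : Set (LinkSpace L) := {x | ∀ e : Edge 3 L, ∑ a, x (e, a) ^ 2 ≤ ρ ^ 2}

omit [NeZero L] in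
/-- Membership of a chart vector. [folklore] -/
theorem chartVec_mem_chartBall_iff (ρ : ℝ) (y : Edge 3 L → Fin 3 → ℝ) :
    chartVec y ∈ chartBall L ρ ↔ ∀ e, ∑ a, y e a ^ 2 ≤ ρ ^ 2 := by
  simp only [chartBall, Set.mem_setOf_eq, chartVec_apply]

omit [NeZero L] in
/-- The chart ball is closed. [folklore] -/
theorem isClosed_chartBall (ρ : ℝ) : IsClosed (chartBall L ρ) := by
  have h : chartBall L ρ = ⋂ e : Edge 3 L, {x : LinkSpace L | ∑ a, x (e, a) ^ 2 ≤ ρ ^ 2} := by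
    ext x; simp [chartBall]
  rw [h]
  refine isClosed_iInter fun e => isClosed_le ?_ continuous_const
  exact continuous_finsetSum _ fun a _ => ((PiLp.continuous_apply 2 _ (e, a)).pow 2)

/-- The chart ball is measurable. [folklore] -/
theorem measurableSet_chartBall (ρ : ℝ) : MeasurableSet (chartBall L ρ) := (isClosed_chartBall ρ).measurableSet

/-! ## §2 The model integrand on the link space -/

/-- The UPPER model integrand at `U`: `x ↦ 𝟙_{ball}(x) · e^{−β(1+ρ²)⁻²‖x‖²} · e^{−(β/2)‖F(U) + D_U x‖²} · Φ(P(x)·U)`,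
`P(x) = latPatternChart (vacuum) (linkCurry x)`. [cite: Luscher1983, §3] -/
def upperModel (β ρ : ℝ) (Φ : GaugeConfig 3 L SU2 → ℝ) (U : GaugeConfig 3 L SU2) (x : LinkSpace L) : ℝ :=
  (chartBall L ρ).indicator
    (fun x => Real.exp (-(β / (1 + ρ ^ 2) ^ 2 * ‖x‖ ^ 2)) * Real.exp (-(β / 2) * ‖plaqCurv U + covCurl U x‖ ^ 2) *
      Φ (latPatternChart L (fun _ => false) (linkCurry x) * U)) x

/-- Measurability of the chart-step map `x ↦ P(x)·U`. [folklore] -/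
theorem measurable_chartStep (U : GaugeConfig 3 L SU2) :
    Measurable fun x : LinkSpace L => latPatternChart L (fun _ => false) (linkCurry x) * U := by
  haveI : SecondCountableTopology SU2 := secondCountableTopology_su2
  have h1 : Measurable (linkCurry : LinkSpace L → Edge 3 L → Fin 3 → ℝ) := by
    rw [show (linkCurry : LinkSpace L → Edge 3 L → Fin 3 → ℝ) = ⇑(chartEquiv L).symm from rfl]
    exact (chartEquiv L).symm.measurable
  exact (continuous_mul_right_config U).measurable.comp ((measurable_latPatternChart L _).comp h1)

/-- The model integrand is measurable. [folklore] -/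
theorem measurable_upperModel (β ρ : ℝ) {Φ : GaugeConfig 3 L SU2 → ℝ} (hΦ : Measurable Φ) (U : GaugeConfig 3 L SU2) :
    Measurable (upperModel β ρ Φ U) := by
  unfold upperModel
  refine Measurable.indicator ?_ (measurableSet_chartBall ρ)
  have hc : Continuous fun x : LinkSpace L => ‖plaqCurv U + covCurl U x‖ ^ 2 :=
    (continuous_const.add (covCurl U).continuous_of_finiteDimensional).norm.pow 2
  refine ((by fun_prop : Measurable fun x : LinkSpace L => Real.exp (-(β / (1 + ρ ^ 2) ^ 2 * ‖x‖ ^ 2))).mul ?_).mul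
    (hΦ.comp (measurable_chartStep U))
  exact (continuous_exp.comp (continuous_const.mul hc)).measurable

/-- The model integrand is dominated by the Gaussian: `|upperModel x| ≤ C · e^{−β(1+ρ²)⁻²‖x‖²}` for `0 ≤ Φ ≤ C`, `β ≥ 0`. [folklore] -/
theorem abs_upperModel_le {β ρ : ℝ} (hβ : 0 ≤ β) {Φ : GaugeConfig 3 L SU2 → ℝ} (hΦ0 : ∀ V, 0 ≤ Φ V) {C : ℝ} (hC : ∀ V, Φ V ≤ C)
    (U : GaugeConfig 3 L SU2) (x : LinkSpace L) :
    |upperModel β ρ Φ U x| ≤ C * Real.exp (-(β / (1 + ρ ^ 2) ^ 2) * ‖x‖ ^ 2) := by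
  have hC0 : 0 ≤ C := (hΦ0 1).trans (hC 1)
  unfold upperModel
  by_cases hx : x ∈ chartBall L ρ
  · rw [Set.indicator_of_mem hx, abs_of_nonneg (mul_nonneg (by positivity) (hΦ0 _))]
    have h1 : Real.exp (-(β / 2) * ‖plaqCurv U + covCurl U x‖ ^ 2) ≤ 1 := by
      rw [Real.exp_le_one_iff, neg_mul, neg_nonpos]; positivity
    calc Real.exp (-(β / (1 + ρ ^ 2) ^ 2 * ‖x‖ ^ 2)) * Real.exp (-(β / 2) * ‖plaqCurv U + covCurl U x‖ ^ 2) *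
          Φ (latPatternChart L (fun _ => false) (linkCurry x) * U)
        ≤ Real.exp (-(β / (1 + ρ ^ 2) ^ 2 * ‖x‖ ^ 2)) * 1 * C :=
          mul_le_mul (mul_le_mul_of_nonneg_left h1 (Real.exp_pos _).le) (hC _) (hΦ0 _) (by positivity)
      _ = C * Real.exp (-(β / (1 + ρ ^ 2) ^ 2) * ‖x‖ ^ 2) := by rw [neg_mul]; ring
  · rw [Set.indicator_of_notMem hx, abs_zero]; positivity

/-- ★ The model integrand is integrable on the link space (`β > 0`). [folklore] -/
theorem integrable_upperModel {β ρ : ℝ} (hβ : 0 < β) {Φ : GaugeConfig 3 L SU2 → ℝ} (hΦ : Measurable Φ) (hΦ0 : ∀ V, 0 ≤ Φ V) {C : ℝ}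
    (hC : ∀ V, Φ V ≤ C) (U : GaugeConfig 3 L SU2) : Integrable (upperModel β ρ Φ U) := by
  have hb : 0 < β / (1 + ρ ^ 2) ^ 2 := by positivity
  have hg := (integrable_rexp_neg_mul_sq_norm (V := LinkSpace L) hb).const_mul C
  refine Integrable.mono' hg (measurable_upperModel β ρ hΦ U).aestronglyMeasurable (ae_of_all _ fun x => ?_)
  rw [Real.norm_eq_abs]
  exact abs_upperModel_le hβ.le hΦ0 hC U x

/-! ## §3 The step is dominated by the model integral -/

/-- The exponent bookkeeping of the upper kernel bound: `e^{−(β/2)(S + (g − η − θ))} = e^{(β/2)(η+θ)} e^{−(β/2)S} e^{−(β/2)g}`. [folklore] -/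
theorem exp_upper_split (β S g η θ : ℝ) :
    Real.exp (-(β / 2) * (S + (g - η - θ))) = Real.exp (β / 2 * (η + θ)) * Real.exp (-(β / 2) * S) * Real.exp (-(β / 2) * g) := by
  rw [← Real.exp_add, ← Real.exp_add]; congr 1; ring

/-- ★★ **THE TRANSFER STEP IS DOMINATED BY THE GAUSSIAN MODEL INTEGRAL.**  For `β > 0`, measurable `0 ≤ Φ ≤ C`, `S(U) ≤ σ ≤ 1/16`, `δ < 1`,
`0 ≤ ρ ≤ 1/100` with `(1−δ)⁻² − 1 ≤ ρ²`:
`(K_βΦ)(U) ≤ (2π²)^{−|E|} e^{2β|E|} e^{(β/2)(η₁+θ)} e^{−(β/2)S(U)} ∫ upperModel β ρ Φ U + e^{2β|E|}e^{−2βδ}C`. [cite: Luscher1983, §3] [cite: SeilerLNP1982, §3] -/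
theorem transferApply_le_far_add_model {β δ ρ σ : ℝ} (hβ : 0 < β) (hδ : δ < 1) (hρ0 : 0 ≤ ρ) (hρ : ρ ≤ 1 / 100)
    (hρδ : ((1 - δ) ^ 2)⁻¹ - 1 ≤ ρ ^ 2) (hσ : σ ≤ 1 / 16) {Φ : GaugeConfig 3 L SU2 → ℝ} (hΦ : Measurable Φ) (hΦ0 : ∀ V, 0 ≤ Φ V)
    {C : ℝ} (hC : ∀ V, Φ V ≤ C) (U : GaugeConfig 3 L SU2) (hS : wilsonAction su2Rep U ≤ σ) :
    transferApply β Φ U ≤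
      ((2 * π ^ 2)⁻¹) ^ Fintype.card (Edge 3 L) * Real.exp (2 * β) ^ Fintype.card (Edge 3 L) *
          Real.exp (β / 2 * (stepErrLo ρ σ (Fintype.card (Plaquette 3 L × Fin 3)) + chartErr ρ σ (Fintype.card (Plaquette 3 L × Fin 3)))) *
          Real.exp (-(β / 2) * wilsonAction su2Rep U) * (∫ x, upperModel β ρ Φ U x) +
        Real.exp (2 * β) ^ Fintype.card (Edge 3 L) * Real.exp (-(2 * β * δ)) * C := by
  have hC' : ∀ V, |Φ V| ≤ C := fun V => abs_le.mpr ⟨by linarith [hΦ0 V, hΦ0 1, hC 1], hC V⟩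
  obtain ⟨-, hup⟩ := transferApply_near_sandwich hβ.le δ hΦ hΦ0 hC U
  refine hup.trans (add_le_add_left ?_ _)
  rw [near_integral_eq_chart β hδ hΦ hC' U]
  -- abbreviations
  set N : ℝ := (Fintype.card (Plaquette 3 L × Fin 3) : ℝ)
  set K : ℝ := ((2 * π ^ 2)⁻¹) ^ Fintype.card (Edge 3 L) * Real.exp (2 * β) ^ Fintype.card (Edge 3 L) *
    Real.exp (β / 2 * (stepErrLo ρ σ N + chartErr ρ σ N)) * Real.exp (-(β / 2) * wilsonAction su2Rep U) with hK
  have hK0 : 0 ≤ K := by positivity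
  -- the model integral, transported to `y`-space
  have htrans : K * ∫ x, upperModel β ρ Φ U x = ∫ y : Edge 3 L → Fin 3 → ℝ, K * upperModel β ρ Φ U (chartVec y) := by
    rw [integral_const_mul, integral_comp_chartVec]
  rw [htrans]
  -- pointwise domination
  refine integral_mono_of_nonneg (ae_of_all _ fun y => ?_) ?_ (ae_of_all _ fun y => ?_)
  · -- non-negativity of the near integrand
    exact mul_nonneg (latGnDensityReal_pos_le L y).1.le (mul_nonneg (nearInd_mem_Icc δ _).1
      (mul_nonneg (transferKernel_pos su2Rep β U _).le (hΦ0 _)))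
  · -- integrability of the model side on `y`-space
    have hi := (integrable_upperModel hβ hΦ hΦ0 hC U (ρ := ρ)).const_mul K
    exact (volume_preserving_chartVec L).integrable_comp_emb (chartEquiv L).measurableEmbedding |>.mpr hi
  · -- the pointwise bound
    show latGnDensityReal L y * (nearInd δ (latPatternChart L (fun _ => false) y) *
        stepIntegrand β Φ U (latPatternChart L (fun _ => false) y)) ≤ K * upperModel β ρ Φ U (chartVec y)
    by_cases hnear : latPatternChart L (fun _ => false) y ∈ nearSet δ
    · have hy : ∀ e, ∑ a, y e a ^ 2 ≤ ρ ^ 2 := fun e => (sum_sq_le_of_near_chart hδ hnear e).trans hρδ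
      have hball : chartVec y ∈ chartBall L ρ := (chartVec_mem_chartBall_iff ρ y).mpr hy
      rw [nearInd_of_mem hnear, one_mul, upperModel, Set.indicator_of_mem hball, linkCurry_chartVec, stepIntegrand]
      obtain ⟨-, hk⟩ := transferKernel_step_model_sandwich U y hβ.le hρ0 hρ hσ hS hy
      have hdens := (latGnDensityReal_pos_le L y).2
      have hΦy := hΦ0 (latPatternChart L (fun _ => false) y * U)
      rw [exp_upper_split] at hk
      calc latGnDensityReal L y * (transferKernel su2Rep β U (latPatternChart L (fun _ => false) y * U) *
            Φ (latPatternChart L (fun _ => false) y * U))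
          ≤ ((2 * π ^ 2)⁻¹) ^ Fintype.card (Edge 3 L) *
              ((Real.exp (2 * β) ^ Fintype.card (Edge 3 L) * Real.exp (-(β / (1 + ρ ^ 2) ^ 2 * ‖chartVec y‖ ^ 2)) *
                (Real.exp (β / 2 * (stepErrLo ρ σ N + chartErr ρ σ N)) * Real.exp (-(β / 2) * wilsonAction su2Rep U) *
                  Real.exp (-(β / 2) * ‖plaqCurv U + covCurl U (chartVec y)‖ ^ 2))) *
              Φ (latPatternChart L (fun _ => false) y * U)) :=
            mul_le_mul hdens (mul_le_mul_of_nonneg_right hk hΦy) (mul_nonneg (transferKernel_pos su2Rep β U _).le hΦy) (by positivity)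
        _ = K * (Real.exp (-(β / (1 + ρ ^ 2) ^ 2 * ‖chartVec y‖ ^ 2)) * Real.exp (-(β / 2) * ‖plaqCurv U + covCurl U (chartVec y)‖ ^ 2) *
              Φ (latPatternChart L (fun _ => false) y * U)) := by rw [hK]; ring
    · rw [nearInd_of_not_mem hnear, zero_mul, mul_zero]
      refine mul_nonneg hK0 ?_
      unfold upperModel
      by_cases hb : chartVec y ∈ chartBall L ρ
      · rw [Set.indicator_of_mem hb]; exact mul_nonneg (by positivity) (hΦ0 _)
      · rw [Set.indicator_of_notMem hb]

end Summit.QuantumFields.YangMills.Theorems.FemtoTransferGap.TwoLattice.Cov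

end
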